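import Summits.Ventures.PercRepro.RankLevelSetOrdered
import Summits.Ventures.PercRepro.RankLevelSetFrameQM
import Summits.Ventures.PercRepro.RankLevelSetAC

/-!
# PercRepro — C-025 from the ORDERED CERTIFICATE on simple coloop-free matroids (night-1, gen 8)

The per-minor bound is EXTENDED by the independent sets: `indepMid N p q` = the number of independent sets of
`N` of size strictly between `q` and `p` — every one of them has its size as rank, so `indepMid ≤ midCount`
with no induction hypothesis at all (`indepMid_le_midCount`); `certEXT p q N = max (certAB p q N) (indepMid N p q)`.

`c025_of_orderedCertEXT`: C-025 for every finite matroid follows from the hypothesis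

  **(OC-EXT)** `OrderedCertEXT` — every SIMPLE, COLOOP-FREE finite matroid of rank `p + 1` with at least
  `p + q + 2` elements (the tight layer of the cell `(p+1, q+1)` included; `q + 2 ≤ p`) has an ordering `l` of its
  ground set with `Φ(p+1, q+1)·#U_M(p+1, q+1) ≤ Σ_j certEXT p q (N_j)`, `N_j = (M ＼ {x₁, …, x_{j−1}}) ／ {x_j}`
  (`Matroid.chainSum (Matroid.certEXT p q) M l`);

and `c025_of_orderedCertAB` from the weaker-looking `OrderedCertAB` (`certAB` in place of `certEXT`, strictly
above the tight layer) — `certAB ≤ certEXT` pointwise.  The wrapper is the cell's `|E|`-induction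
(RankLevelSetContractMonoCore, itself `rls_succ_all` of RankLevelSetFrameQ) with the hypothesis replaced: loops
halve, a parallel pair is Theorem F, `|E| < p + q` is Theorem M, `ρ(E) < p` is empty, `ρ(E) > p` truncates, a
coloop is Lemma J₂, `q = 0` is Theorem A, and on a simple coloop-free rank-`p` matroid with `|E| ≥ p + q` the
ordered bridge `RLS_of_chainSum` closes the cell from the induction hypothesis on the chain minors (fewer
elements, cells `(p−1, q)` and `(p−1, q−1)`).  No `e`-free condition is needed.

Census (night-1 g8, mining/night-1/g8/): (OC-EXT-∀) holds for EVERY ordering on every loopless rank-`p`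
matroid with ≤ 9 elements and `|E| ≥ p + q`, at every cell (tight layer included) — but WITHOUT the simple
hypothesis it FAILS at 10 elements (the free extension of `U_{4,4} ⊕ U_{1,5}`, a 5-element parallel class,
cell `(5, 2)`: worst ordering `0.96 ×` the need, best `1.27`), so `OrderedCertEXTAll` is stated for SIMPLE
coloop-free matroids only (every simple 10-element free extension sampled passes); on the truncated stars
`T_p(U_{2,3}^a ⊕ U_{f,f})` at the boundary cells `(7,4) … (9,6)` (worst ordering ≥ 1.055 × the need) and on
the bond matroid `M(K₆)*` at `(10, 4)` (1.609 × the need).  (OC-AB) is FALSE AS STATED: `M(K₆)*` (15 elements,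
rank 10, simple, coloop-free) has NO ordering satisfying it at `(10, 4)` — the maximum over all `15!` orderings is
`0.958 ×` the need (mine-4, INBOX 8022, two implementations) — and `U_{20,35}` fails it at `(20, 14)` (closed
form); `c025_of_orderedCertAB` is kept as the reduction it is, with a hypothesis known to be false in general.
(OC-EXT-∀) is a reduction and evidence, not a theorem.  Axioms: standard.
-/

open scoped Matroid

namespace PercRepro

namespace Matroid

open Set

variable {α : Type}

/-- `I_{(q,p)}(N)`: the number of independent sets of `N` of size strictly between `q` and `p`. -/
noncomputable def indepMid (N : _root_.Matroid α) (p q : ℕ) : ℕ :=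
  {A : Set α | A ⊆ N.E ∧ N.Indep A ∧ q < A.ncard ∧ A.ncard < p}.ncard

/-- An independent set has its size as rank, so `indepMid N p q ≤ #Y_N(p, q)` — no induction hypothesis. -/
theorem indepMid_le_midCount (N : _root_.Matroid α) [N.Finite] (p q : ℕ) :
    indepMid N p q ≤ midCount N p q := by
  unfold indepMid midCount
  refine Set.ncard_le_ncard ?_ (N.ground_finite.finite_subsets.subset fun _ hA => hA.1)
  rintro A ⟨hA, hI, h1, h2⟩
  have hfin : A.Finite := N.ground_finite.subset hA
  refine ⟨hA, ?_, ?_⟩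
  · rw [hI.eRk_eq_encard, ← hfin.cast_ncard_eq]
    exact_mod_cast h1
  · rw [hI.eRk_eq_encard, ← hfin.cast_ncard_eq]
    exact_mod_cast h2

/-- The per-minor bound of certificate EXT: `c_EXT(N) = max (c_AB N) (I_{(q,p)}(N))`. -/
noncomputable def certEXT (p q : ℕ) (N : _root_.Matroid α) : ℚ :=
  max (certAB p q N) (indepMid N p q : ℚ)

/-- `certAB ≤ certEXT`. -/
theorem certAB_le_certEXT (p q : ℕ) (N : _root_.Matroid α) : certAB p q N ≤ certEXT p q N :=
  le_max_left _ _

/-- `c_EXT(N) ≤ #Y_N(p, q)` from C-025 for `N` at `(p, q+1)` and at `(p, q)`. -/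
theorem certEXT_le_midCount (N : _root_.Matroid α) [N.Finite] {p q : ℕ} (h : q + 2 ≤ p)
    (hN : ThmN.RLS N p (q + 1)) (hN' : ThmN.RLS N p q) : certEXT p q N ≤ (midCount N p q : ℚ) := by
  unfold certEXT
  refine max_le (certAB_le_midCount N h hN hN') ?_
  exact_mod_cast indepMid_le_midCount N p q

/-- **C-025 FROM CERTIFICATE EXT** along some ordering, with C-025 at `(p, q+1)` and `(p, q)` on the smaller
matroids. -/
theorem RLS_of_chainCertEXT (M : _root_.Matroid α) [M.Finite] {p q : ℕ} (h : q + 2 ≤ p)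
    (l : List α) (hl : l.Nodup) (hE : M.E = {x | x ∈ l}) (hnl : ∀ x ∈ l, M.Indep {x})
    (hIH : ∀ (N : _root_.Matroid α) [N.Finite], N.E.ncard < M.E.ncard → ThmN.RLS N p (q + 1))
    (hIH' : ∀ (N : _root_.Matroid α) [N.Finite], N.E.ncard < M.E.ncard → ThmN.RLS N p q)
    (hcert : phiK (p + 1) (q + 1) * (topCount M (p + 1) (q + 1) : ℚ) ≤ chainSum (certEXT p q) M l) :
    ThmN.RLS M (p + 1) (q + 1) :=
  RLS_of_chainSum M p q (certEXT p q) l hl hE hnl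
    (fun N _ hN => certEXT_le_midCount N h (hIH N hN) (hIH' N hN)) hcert

/-- A chain sum is monotone in the per-minor bound. -/
theorem chainSum_mono {c c' : _root_.Matroid α → ℚ} (hcc : ∀ N, c N ≤ c' N) :
    ∀ (l : List α) (M : _root_.Matroid α), chainSum c M l ≤ chainSum c' M l := by
  intro l
  induction l with
  | nil => intro M; simp
  | cons x l ih =>
    intro M
    rw [chainSum_cons, chainSum_cons]
    exact add_le_add (hcc _) (ih _)

end Matroid

namespace ThmN

open Set

variable {α : Type}

/-- **(OC-EXT) — THE ORDERED CERTIFICATE on simple coloop-free matroids**: for every simple, coloop-free finite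
matroid of rank `p + 1` with `|E| ≥ p + q + 2` and `q + 2 ≤ p`, some ordering `l` of the ground set satisfies
`Φ(p+1, q+1)·#U_M(p+1, q+1) ≤ Σ_j c_EXT(N_j)` along its chain of minors. -/
def OrderedCertEXT : Prop :=
  ∀ {α : Type} (M : Matroid α) [M.Finite] (p q : ℕ), q + 2 ≤ p →
    (∀ e ∈ M.E, ∀ f ∈ M.E, e ≠ f → M.eRk {e, f} = 2) → M.eRank = ((p + 1 : ℕ) : ℕ∞) →
    (∀ e, ¬ M.IsColoop e) → p + q + 2 ≤ M.E.ncard →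
    ∃ l : List α, l.Nodup ∧ M.E = {x | x ∈ l} ∧
      phiK (p + 1) (q + 1) * (Matroid.topCount M (p + 1) (q + 1) : ℚ) ≤
        Matroid.chainSum (Matroid.certEXT p q) M l

/-- **(OC-EXT-∀) — the ordered certificate for EVERY ordering**: the inequality of `OrderedCertEXT` for every
listing `l` of the ground set (the census form of record: on every simple coloop-free matroid with ≤ 9 elements
and `|E| ≥ p + q` it holds for every one of the `n!` orderings, with equality in the worst ordering exactly on
the tight layer; the SIMPLE hypothesis is load-bearing — a 5-element parallel class breaks the ∀-form at 10
elements while the ∃-form `OrderedCertEXT` survives there). -/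
def OrderedCertEXTAll : Prop :=
  ∀ {α : Type} (M : Matroid α) [M.Finite] (p q : ℕ), q + 2 ≤ p →
    (∀ e ∈ M.E, ∀ f ∈ M.E, e ≠ f → M.eRk {e, f} = 2) → M.eRank = ((p + 1 : ℕ) : ℕ∞) →
    (∀ e, ¬ M.IsColoop e) → p + q + 2 ≤ M.E.ncard →
    ∀ l : List α, l.Nodup → M.E = {x | x ∈ l} →
      phiK (p + 1) (q + 1) * (Matroid.topCount M (p + 1) (q + 1) : ℚ) ≤
        Matroid.chainSum (Matroid.certEXT p q) M l

/-- (OC-EXT-∀) implies (OC-EXT): the ground set of a finite matroid has a listing. -/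
theorem orderedCertEXT_of_all (h : OrderedCertEXTAll) : OrderedCertEXT := by
  intro α M _ p q hpq hs hR hC hn
  classical
  refine ⟨M.ground_finite.toFinset.toList, Finset.nodup_toList _, ?_, ?_⟩
  · ext x
    simp only [Set.mem_setOf_eq, Finset.mem_toList, Set.Finite.mem_toFinset]
  · refine h M p q hpq hs hR hC hn _ (Finset.nodup_toList _) ?_
    ext x
    simp only [Set.mem_setOf_eq, Finset.mem_toList, Set.Finite.mem_toFinset]

/-- **(OC-AB)**: the same with `c_AB` in place of `c_EXT`, strictly above the tight layer.  FALSE AS STATED: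
`M(K₆)*` at `(10, 4)` admits no such ordering (mine-4, INBOX 8022), nor does `U_{20,35}` at `(20, 14)`; kept as
the hypothesis of the reduction `c025_of_orderedCertAB` only. -/
def OrderedCertAB : Prop :=
  ∀ {α : Type} (M : Matroid α) [M.Finite] (p q : ℕ), q + 2 ≤ p →
    (∀ e ∈ M.E, ∀ f ∈ M.E, e ≠ f → M.eRk {e, f} = 2) → M.eRank = ((p + 1 : ℕ) : ℕ∞) →
    (∀ e, ¬ M.IsColoop e) → p + q + 2 < M.E.ncard →
    ∃ l : List α, l.Nodup ∧ M.E = {x | x ∈ l} ∧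
      phiK (p + 1) (q + 1) * (Matroid.topCount M (p + 1) (q + 1) : ℚ) ≤
        Matroid.chainSum (Matroid.certAB p q) M l

/-- The core step: from the ordered certificate EXT and the induction hypothesis on smaller matroids. -/
theorem RLS_of_orderedCert_step (M : Matroid α) [M.Finite] {p q : ℕ} (hpq : q + 2 ≤ p)
    (hL : ∀ e ∈ M.E, ¬ M.IsLoop e)
    (ih : ∀ (N : Matroid α) [N.Finite], N.E.ncard < M.E.ncard → ∀ p' q' : ℕ, q' + 2 ≤ p' → RLS N p' q')
    (hcert : ∃ l : List α, l.Nodup ∧ M.E = {x | x ∈ l} ∧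
      phiK (p + 1) (q + 1) * (Matroid.topCount M (p + 1) (q + 1) : ℚ) ≤
        Matroid.chainSum (Matroid.certEXT p q) M l) :
    RLS M (p + 1) (q + 1) := by
  obtain ⟨l, hl, hE, hc⟩ := hcert
  refine Matroid.RLS_of_chainCertEXT M hpq l hl hE ?_ ?_ ?_ hc
  · intro x hx
    have hxE : x ∈ M.E := hE ▸ hx
    exact _root_.Matroid.indep_singleton.2 ((_root_.Matroid.not_isLoop_iff hxE).1 (hL x hxE))
  · intro N _ hN
    rcases Nat.lt_or_ge (q + 1 + 2) (p + 1) with h | h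
    · exact ih N hN p (q + 1) (by omega)
    · exact RLS_of_le N (by omega)
  · intro N _ hN
    exact ih N hN p q hpq

/-- **C-025 FROM (OC-EXT)** — strong induction on `|E|` for all `(p, q)` at once; the cell's reductions for
everything that is not simple, coloop-free, of rank `p`, with `|E| ≥ p + q`. -/
theorem c025_of_orderedCertEXT (hOC : OrderedCertEXT) : C025 := by
  suffices H : ∀ n : ℕ, ∀ {α : Type} (M : Matroid α) [M.Finite], M.E.ncard = n → ∀ p q : ℕ, q + 2 ≤ p →
      RLS M p q by
    intro α M _ p q hpq
    exact H _ M rfl p q hpq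
  intro n
  induction n using Nat.strong_induction_on with
  | _ n ih =>
  intro α M _ hn p q hpq
  classical
  -- `q = 0` is Theorem A
  rcases Nat.eq_zero_or_pos q with hq0 | hq1
  · subst hq0
    exact c025_of_q_zero (M := M) p
  have hdel : ∀ e ∈ M.E, (M ＼ {e}).E.ncard < n := by
    intro e he
    rw [_root_.Matroid.delete_ground, ← hn, ← Set.ncard_sdiff_singleton_add_one he M.ground_finite]
    omega
  have hcon : ∀ e ∈ M.E, (M ／ {e}).E.ncard < n := by
    intro e he
    rw [_root_.Matroid.contract_ground, ← hn, ← Set.ncard_sdiff_singleton_add_one he M.ground_finite]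
    omega
  have ihM : ∀ (N : Matroid α) [N.Finite], N.E.ncard < M.E.ncard → ∀ p' q' : ℕ, q' + 2 ≤ p' → RLS N p' q' := by
    intro N _ hN p' q' h
    exact ih _ (hn ▸ hN) N rfl p' q' h
  -- Case 1: a loop
  by_cases hL : ∃ e ∈ M.E, M.IsLoop e
  · obtain ⟨e, he, hloopE⟩ := hL
    exact RLS_of_loop_q M hloopE p q (ih _ (hdel e he) (M ＼ {e}) rfl p q hpq)
  push Not at hL
  -- Case 2: a parallel pair
  by_cases hP : ∃ e ∈ M.E, ∃ e' ∈ M.E, e' ≠ e ∧ e ∈ M.closure {e'}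
  · obtain ⟨e, he, e', he', hne, hpar⟩ := hP
    have heI : M.Indep {e} := _root_.Matroid.indep_singleton.2 ((_root_.Matroid.not_isLoop_iff he).1 (hL e he))
    obtain ⟨p', rfl⟩ : ∃ p', p = p' + 1 := ⟨p - 1, by omega⟩
    obtain ⟨q', rfl⟩ : ∃ q', q = q' + 1 := ⟨q - 1, by omega⟩
    exact RLS_of_parallel_q M heI he' hne hpar (ih _ (hdel e he) (M ＼ {e}) rfl (p' + 1) (q' + 1) hpq)
      (ih _ (hcon e he) (M ／ {e}) rfl p' q' (by omega))
  push Not at hP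
  -- Case 3: simple
  have hs : ∀ e ∈ M.E, ∀ f ∈ M.E, e ≠ f → M.eRk {e, f} = 2 :=
    fun e he f hf hef => eRk_pair_eq_two_of_simple M hL (fun e he e' he' hne => hP e he e' he' hne) he hf hef
  -- below the tight layer: Theorem M
  rcases Nat.lt_or_ge M.E.ncard (p + q) with hsmall | hbig
  · exact RLS_of_ncard_lt M hsmall
  obtain ⟨p', rfl⟩ : ∃ p', p = p' + 1 := ⟨p - 1, by omega⟩
  obtain ⟨q', rfl⟩ : ∃ q', q = q' + 1 := ⟨q - 1, by omega⟩
  rcases lt_trichotomy M.eRank ((p' + 1 : ℕ) : ℕ∞) with hlt | heq | hgt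
  · exact RLS_of_eRank_lt M hlt
  · -- `ρ(E) = p`
    by_cases hC : ∃ e, M.IsColoop e
    · obtain ⟨e, hcol⟩ := hC
      refine RLS_of_coloop_q M (by omega) hcol heq ?_
      rcases Nat.lt_or_ge (q' + 2) p' with h | h
      · exact ih _ (hdel e hcol.mem_ground) (M ＼ {e}) rfl p' (q' + 1) (by omega)
      · exact RLS_of_le (M ＼ {e}) (by omega)
    · push Not at hC
      exact RLS_of_orderedCert_step M (by omega) hL ihM
        (hOC M p' q' (by omega) hs heq hC (by omega))
  · -- `ρ(E) > p`: truncate, then the same on the truncation (same ground set)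
    have hp2 : 2 ≤ p' + 1 := by omega
    set T := Matroid.truncate M (p' + 1) with hTdef
    have hTs := truncate_pair_eRk M hp2 hs
    have hTR := truncate_eRank_eq M hgt
    have hTc := truncate_no_coloop M hgt
    have hTE : T.E = M.E := Matroid.truncate_ground M (p' + 1)
    have hTn : T.E.ncard = n := by rw [hTE, hn]
    have hTL : ∀ e ∈ T.E, ¬ T.IsLoop e := by
      intro e he
      rw [_root_.Matroid.not_isLoop_iff he, ← _root_.Matroid.indep_singleton, Matroid.truncate_indep_iff]
      refine ⟨_root_.Matroid.indep_singleton.2 ((_root_.Matroid.not_isLoop_iff (hTE ▸ he)).1 (hL e (hTE ▸ he))), ?_⟩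
      rw [Set.ncard_singleton]; omega
    have ihT : ∀ (N : Matroid α) [N.Finite], N.E.ncard < T.E.ncard → ∀ p'' q'' : ℕ, q'' + 2 ≤ p'' →
        RLS N p'' q'' := by
      intro N _ hN p'' q'' h
      exact ih _ (hTn ▸ hN) N rfl p'' q'' h
    have hT : RLS T (p' + 1) (q' + 1) :=
      RLS_of_orderedCert_step T (by omega) hTL ihT (hOC T p' q' (by omega) hTs hTR hTc (by rw [hTE]; omega))
    unfold RLS at hT ⊢
    exact Matroid.rls_of_truncate M (p' + 1) (by omega) (phiK (p' + 1) (q' + 1)) (by unfold phiK; positivity) hT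

/-- **C-025 FROM (OC-AB)**: the same wrapper, with Theorem M on the tight layer `|E| = p + q` and the AB
certificate lifted to an EXT certificate above it (`certAB ≤ certEXT`, `chainSum_mono`). -/
theorem c025_of_orderedCertAB (hOC : OrderedCertAB) : C025 := by
  suffices H : ∀ n : ℕ, ∀ {α : Type} (M : Matroid α) [M.Finite], M.E.ncard = n → ∀ p q : ℕ, q + 2 ≤ p →
      RLS M p q by
    intro α M _ p q hpq
    exact H _ M rfl p q hpq
  intro n
  induction n using Nat.strong_induction_on with
  | _ n ih =>
  intro α M _ hn p q hpq
  classical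
  rcases Nat.eq_zero_or_pos q with hq0 | hq1
  · subst hq0
    exact c025_of_q_zero (M := M) p
  have hdel : ∀ e ∈ M.E, (M ＼ {e}).E.ncard < n := by
    intro e he
    rw [_root_.Matroid.delete_ground, ← hn, ← Set.ncard_sdiff_singleton_add_one he M.ground_finite]
    omega
  have hcon : ∀ e ∈ M.E, (M ／ {e}).E.ncard < n := by
    intro e he
    rw [_root_.Matroid.contract_ground, ← hn, ← Set.ncard_sdiff_singleton_add_one he M.ground_finite]
    omega
  have ihM : ∀ (N : Matroid α) [N.Finite], N.E.ncard < M.E.ncard → ∀ p' q' : ℕ, q' + 2 ≤ p' → RLS N p' q' := by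
    intro N _ hN p' q' h
    exact ih _ (hn ▸ hN) N rfl p' q' h
  by_cases hL : ∃ e ∈ M.E, M.IsLoop e
  · obtain ⟨e, he, hloopE⟩ := hL
    exact RLS_of_loop_q M hloopE p q (ih _ (hdel e he) (M ＼ {e}) rfl p q hpq)
  push Not at hL
  by_cases hP : ∃ e ∈ M.E, ∃ e' ∈ M.E, e' ≠ e ∧ e ∈ M.closure {e'}
  · obtain ⟨e, he, e', he', hne, hpar⟩ := hP
    have heI : M.Indep {e} := _root_.Matroid.indep_singleton.2 ((_root_.Matroid.not_isLoop_iff he).1 (hL e he))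
    obtain ⟨p', rfl⟩ : ∃ p', p = p' + 1 := ⟨p - 1, by omega⟩
    obtain ⟨q', rfl⟩ : ∃ q', q = q' + 1 := ⟨q - 1, by omega⟩
    exact RLS_of_parallel_q M heI he' hne hpar (ih _ (hdel e he) (M ＼ {e}) rfl (p' + 1) (q' + 1) hpq)
      (ih _ (hcon e he) (M ／ {e}) rfl p' q' (by omega))
  push Not at hP
  have hs : ∀ e ∈ M.E, ∀ f ∈ M.E, e ≠ f → M.eRk {e, f} = 2 :=
    fun e he f hf hef => eRk_pair_eq_two_of_simple M hL (fun e he e' he' hne => hP e he e' he' hne) he hf hef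
  rcases lt_trichotomy M.E.ncard (p + q) with hsmall | htight | hbig
  · exact RLS_of_ncard_lt M hsmall
  · exact RLS_of_ncard_eq M htight
  obtain ⟨p', rfl⟩ : ∃ p', p = p' + 1 := ⟨p - 1, by omega⟩
  obtain ⟨q', rfl⟩ : ∃ q', q = q' + 1 := ⟨q - 1, by omega⟩
  -- the AB certificate is an EXT certificate
  have hlift : ∀ (N : Matroid α) [N.Finite], (∃ l : List α, l.Nodup ∧ N.E = {x | x ∈ l} ∧
      phiK (p' + 1) (q' + 1) * (Matroid.topCount N (p' + 1) (q' + 1) : ℚ) ≤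
        Matroid.chainSum (Matroid.certAB p' q') N l) →
      ∃ l : List α, l.Nodup ∧ N.E = {x | x ∈ l} ∧
      phiK (p' + 1) (q' + 1) * (Matroid.topCount N (p' + 1) (q' + 1) : ℚ) ≤
        Matroid.chainSum (Matroid.certEXT p' q') N l := by
    rintro N _ ⟨l, hl, hE, hc⟩
    exact ⟨l, hl, hE, le_trans hc (Matroid.chainSum_mono (Matroid.certAB_le_certEXT p' q') l N)⟩
  rcases lt_trichotomy M.eRank ((p' + 1 : ℕ) : ℕ∞) with hlt | heq | hgt
  · exact RLS_of_eRank_lt M hlt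
  · by_cases hC : ∃ e, M.IsColoop e
    · obtain ⟨e, hcol⟩ := hC
      refine RLS_of_coloop_q M (by omega) hcol heq ?_
      rcases Nat.lt_or_ge (q' + 2) p' with h | h
      · exact ih _ (hdel e hcol.mem_ground) (M ＼ {e}) rfl p' (q' + 1) (by omega)
      · exact RLS_of_le (M ＼ {e}) (by omega)
    · push Not at hC
      exact RLS_of_orderedCert_step M (by omega) hL ihM
        (hlift M (hOC M p' q' (by omega) hs heq hC (by omega)))
  · have hp2 : 2 ≤ p' + 1 := by omega
    set T := Matroid.truncate M (p' + 1) with hTdef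
    have hTs := truncate_pair_eRk M hp2 hs
    have hTR := truncate_eRank_eq M hgt
    have hTc := truncate_no_coloop M hgt
    have hTE : T.E = M.E := Matroid.truncate_ground M (p' + 1)
    have hTn : T.E.ncard = n := by rw [hTE, hn]
    have hTL : ∀ e ∈ T.E, ¬ T.IsLoop e := by
      intro e he
      rw [_root_.Matroid.not_isLoop_iff he, ← _root_.Matroid.indep_singleton, Matroid.truncate_indep_iff]
      refine ⟨_root_.Matroid.indep_singleton.2 ((_root_.Matroid.not_isLoop_iff (hTE ▸ he)).1 (hL e (hTE ▸ he))), ?_⟩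
      rw [Set.ncard_singleton]; omega
    have ihT : ∀ (N : Matroid α) [N.Finite], N.E.ncard < T.E.ncard → ∀ p'' q'' : ℕ, q'' + 2 ≤ p'' →
        RLS N p'' q'' := by
      intro N _ hN p'' q'' h
      exact ih _ (hTn ▸ hN) N rfl p'' q'' h
    have hT : RLS T (p' + 1) (q' + 1) :=
      RLS_of_orderedCert_step T (by omega) hTL ihT
        (hlift T (hOC T p' q' (by omega) hTs hTR hTc (by rw [hTE]; omega)))
    unfold RLS at hT ⊢
    exact Matroid.rls_of_truncate M (p' + 1) (by omega) (phiK (p' + 1) (q' + 1)) (by unfold phiK; positivity) hT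

/-- **C-025 FROM (OC-EXT-∀)**. -/
theorem c025_of_orderedCertEXTAll (h : OrderedCertEXTAll) : C025 :=
  c025_of_orderedCertEXT (orderedCertEXT_of_all h)

end ThmN

end PercRepro
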